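import Literature.Computability.Complexity.CodeFPListKit
import Literature.Computability.Complexity.CodeFPBudgets
import Literature.Computability.Complexity.CodeFPLists
import Literature.Computability.Complexity.CodeFPFinite
import Literature.Computability.Complexity.CodeFPStringKit
import Literature.Computability.Complexity.CodeFPStrings
import Literature.Computability.Complexity.CookBridges
import Summits.PneNP.PneNP.Theorems.SignDeg2AvoidAffineSplitCorrect

/-!
# ROUND-18 item K3 `AffineSplit k` — part 3/3: polynomial time, and the theorem `affineSplit`

Cell pnp-ideate (route packet `SignDeg2Avoid`, item K3 = `Summit.PneNP.PneNP.Theorems.SignDeg2Signing.AffineSplit`).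
The affine-split machine `affStr k f₀` of part 1 is typed in the tree's `CodeFP` algebra — a finite lookup
(`affRow`), maps / filters / an indexed map over the decoded outputs, the span test `Nc03Reduction.codeFP_inSpan`
inside a `findIdx`, string assembly of the sub-instance code, ONE call of the hypothesised polynomial-time `f₀`
(`CodeFP.of_fn` via `CookBridges.isPolyTime_iff`), and a branch — hence `IsPolyTime (affStr k f₀)` whenever
`IsPolyTime f₀` (`isPolyTime_affStr`).  With part 2's `affStr_correct` this proves, for EVERY locality `k`,

  `affineSplit k : AffineSplit k` — `SignDeg2OnlyAvoidLinearFP k → SignDeg2AvoidLinearFP k`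

(an FP range-avoider at linear stretch for the all-sign-degree-≤2 `k`-local maps yields one, at stretch
`(C₀+1)·n`, for the maps each of whose tables has sign-degree `≤ 2` or is affine).  Restricted-model algorithmic
glue of the range-avoidance ladder; it says nothing about `P` versus `NP`.
-/

set_option linter.dupNamespace false -- `Summit.PneNP.PneNP.…`: summit = sub-problem name (D-0017 single-conjunct layout)

namespace Summit.PneNP.PneNP.Theorems.AffineSplitFP

open Literature.Computability.Complexity
open Summit.PneNP.PneNP.Theorems.SignDeg2Signing (IsAffinePred SignDeg2OnlyAvoidLinearFP SignDeg2AvoidLinearFP AffineSplit)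
open Summit.PneNP.PneNP.Theorems.LtfLocalAvoidFP (allBits tableOfBits)
open Summit.PneNP.PneNP.Theorems.LocalMapDecodeFP (decode hdrN outE codeFP_decode codeFP_hdrN)
open Summit.PneNP.PneNP.Theorems.Nc03Reduction (inSpan codeFP_inSpan)

section PolyTime

open CodeFP

/-- Code of the affine data `(affine?, (row, constant bit))`. -/
abbrev aE : Bool × (List ℕ × Bool) → List Bool := pairE bitE (pairE (rawE natE) bitE)

/-- Code of a classified output. -/
abbrev recE : Rec → List Bool := pairE natE aE

variable (k : ℕ)

/-- The affine data of a table block is a finite lookup, hence polynomial time. -/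
theorem codeFP_affRow : CodeFP strE aE (affRow k) := by
  have he : Function.Injective strE := fun _ _ h => h
  exact (ofList (eα := strE) he aE (fun tab => affData (tableOfBits k tab)) (false, ([], false)) (allBits (2 ^ k))).congr
    fun tab => by unfold affRow; split_ifs <;> rfl

/-- Classifying a decoded output is polynomial time. -/
theorem codeFP_cls : CodeFP outE aE (cls k) := by
  have ha : CodeFP outE aE (fun o => affRow k o.1) := ((codeFP_affRow k).comp (fst strE (rawE natE))).congr fun _ => rfl
  have hrow : CodeFP outE (rawE natE) (fun o => (affRow k o.1).2.1.map fun i => o.2.getD i 0) :=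
    ((map (σ := List ℕ) (eσ := rawE natE) (α := ℕ) (eα := natE) (g := fun q => q.1.getD q.2 0)
      (rawGetD natE (d := 0) natE_zero)).comp ((snd strE (rawE natE)).pair ha.snd'.fst')).congr fun _ => rfl
  exact (ha.fst'.pair (hrow.pair ha.snd'.snd')).congr fun _ => rfl

/-- Classifying and indexing all outputs is polynomial time. -/
theorem codeFP_recs : CodeFP (rawE outE) (rawE recE) (recs k) := by
  have hg : CodeFP (pairE unitE (pairE natE outE)) recE (fun t => (t.2.1, cls k t.2.2)) :=
    (snd unitE (pairE natE outE)).fst'.pair ((codeFP_cls k).comp (snd unitE (pairE natE outE)).snd')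
  exact ((mapIdx (σ := Unit) (eσ := unitE) hg).comp ((const _ ()).pair (CodeFP.id _))).congr fun _ => rfl

/-- Selecting the affine records is polynomial time. -/
theorem codeFP_affRecs : CodeFP (rawE recE) (rawE recE) affRecs := by
  have hp : CodeFP (pairE unitE recE) bitE (fun t => t.2.2.1) := (snd unitE recE).snd'.fst'
  exact ((filter hp).comp ((const _ ()).pair (CodeFP.id _))).congr fun _ => rfl

/-- The non-affine indices are polynomial time. -/
theorem codeFP_nonIdx : CodeFP (rawE recE) (rawE natE) nonIdx := by
  have hp : CodeFP (pairE unitE recE) bitE (fun t => !t.2.2.1) := (snd unitE recE).snd'.fst'.not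
  exact ((map₀ (fst natE aE)).comp ((filter hp).comp ((const _ ()).pair (CodeFP.id _)))).congr fun _ => rfl

/-- The rows are polynomial time. -/
theorem codeFP_rowsOf : CodeFP (rawE recE) (rawE (rawE natE)) rowsOf := (map₀ (snd natE aE).snd'.fst').congr fun _ => rfl

/-- **Finding the first dependent row is polynomial time** (a `findIdx` over the span test). -/
theorem codeFP_tStar : CodeFP (pairE unE (rawE (rawE natE))) natE (fun p => tStar p.1 p.2) := by
  have hN : CodeFP (pairE (pairE unE (rawE (rawE natE))) natE) unE (fun q => q.1.1) := (fst _ _).fst'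
  have hrows : CodeFP (pairE (pairE unE (rawE (rawE natE))) natE) (rawE (rawE natE)) (fun q => q.1.2) := (fst _ _).snd'
  have ht : CodeFP (pairE (pairE unE (rawE (rawE natE))) natE) natE (fun q => q.2) := snd _ _
  have htake : CodeFP (pairE (pairE unE (rawE (rawE natE))) natE) (rawE (rawE natE)) (fun q => q.1.2.take q.2) :=
    ((rawTakeNat (rawE natE)).comp (ht.pair hrows)).congr fun _ => rfl
  have hget : CodeFP (pairE (pairE unE (rawE (rawE natE))) natE) (rawE natE) (fun q => q.1.2.getD q.2 []) :=
    ((rawGetD (rawE natE) (d := []) rfl).comp (hrows.pair ht)).congr fun _ => rfl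
  have hp : CodeFP (pairE (pairE unE (rawE (rawE natE))) natE) bitE
      (fun q => inSpan q.1.1 (q.1.2.take q.2) (q.1.2.getD q.2 [])) :=
    (codeFP_inSpan.comp (hN.pair (htake.pair hget))).congr fun _ => rfl
  have hrange : CodeFP (pairE unE (rawE (rawE natE))) (rawE natE) (fun p => List.range p.2.length) :=
    (urange.comp ((ulength (rawE natE)).comp (snd unE (rawE (rawE natE))))).congr fun _ => rfl
  exact ((findIdxFP hp).comp ((CodeFP.id _).pair hrange)).congr fun _ => rfl

/-- The output index of the first dependent affine row is polynomial time. -/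
theorem codeFP_jStar : CodeFP (pairE unE (rawE recE)) natE (fun p => jStar p.1 p.2) := by
  have hidx : CodeFP (pairE unE (rawE recE)) (rawE natE) (fun p => p.2.map Prod.fst) :=
    ((map₀ (fst natE aE)).comp (snd unE (rawE recE))).congr fun _ => rfl
  have hrows : CodeFP (pairE unE (rawE recE)) (rawE (rawE natE)) (fun p => rowsOf p.2) :=
    (codeFP_rowsOf.comp (snd unE (rawE recE))).congr fun _ => rfl
  have ht : CodeFP (pairE unE (rawE recE)) natE (fun p => tStar p.1 (rowsOf p.2)) :=
    (codeFP_tStar.comp ((fst unE (rawE recE)).pair hrows)).congr fun _ => rfl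
  exact ((rawGetD natE (d := 0) natE_zero).comp (hidx.pair ht)).congr fun _ => rfl

/-- Branch A is polynomial time. -/
theorem codeFP_outA : CodeFP (pairE unE (rawE recE)) (rawE bitE) (fun p => outA p.1 p.2) := by
  have haff : CodeFP (pairE unE (rawE recE)) (rawE recE) (fun p => affRecs p.2) :=
    (codeFP_affRecs.comp (snd unE (rawE recE))).congr fun _ => rfl
  have hj : CodeFP (pairE unE (rawE recE)) natE (fun p => jStar p.1 (affRecs p.2)) :=
    (codeFP_jStar.comp ((fst unE (rawE recE)).pair haff)).congr fun _ => rfl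
  have hg : CodeFP (pairE natE recE) bitE (fun t => t.2.2.1 && (t.2.2.2.2 ^^ (t.2.1 == t.1))) :=
    (snd natE recE).snd'.fst'.and (((snd natE recE).snd'.snd'.snd').xor
      ((beq natE_injective).comp ((snd natE recE).fst'.pair (fst natE recE))))
  exact ((map hg).comp (hj.pair (snd _ _))).congr fun _ => rfl

/-- A unary numeral's self-delimiting code is polynomial time. -/
theorem codeFP_unaryCode : CodeFP unE strE LocalMap.unaryCode :=
  (strAppend.comp (strOfUn.pair (const unE [false]))).congr fun a => by
    show unE a ++ [false] = LocalMap.unaryCode a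
    rw [unE_eq_ones]; rfl

/-- Rebuilding a code block is polynomial time. -/
theorem codeFP_blk : CodeFP (pairE unE outE) strE (fun p => blk p.1 p.2) := by
  have hu : CodeFP (pairE unE natE) strE (fun q => LocalMap.unaryCode (min q.2 q.1)) :=
    (codeFP_unaryCode.comp unOfNatMin).congr fun _ => rfl
  have hpos : CodeFP (pairE unE outE) strE (fun p => (p.2.2.map fun v => LocalMap.unaryCode (min v p.1)).flatten) :=
    (strFlatten.comp ((map hu).comp ((fst unE outE).pair (snd unE outE).snd'))).congr fun _ => rfl
  exact (strAppend.comp ((snd unE outE).fst'.pair hpos)).congr fun _ => rfl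

/-- Selecting the non-affine outputs is polynomial time. -/
theorem codeFP_subOuts : CodeFP (rawE outE) (rawE outE) (subOuts k) := by
  have hp : CodeFP (pairE unitE outE) bitE (fun t => !(affRow k t.2.1).1) :=
    ((codeFP_affRow k).comp (snd unitE outE).fst').fst'.not
  exact ((filter hp).comp ((const _ ()).pair (CodeFP.id _))).congr fun _ => rfl

/-- Assembling the sub-instance code is polynomial time. -/
theorem codeFP_subCode : CodeFP (pairE unE (rawE outE)) strE (fun p => subCode k p.1 p.2) := by
  have hsub : CodeFP (pairE unE (rawE outE)) (rawE outE) (fun p => subOuts k p.2) :=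
    ((codeFP_subOuts k).comp (snd unE (rawE outE))).congr fun _ => rfl
  have hN : CodeFP (pairE unE (rawE outE)) strE (fun p => LocalMap.unaryCode p.1) :=
    (codeFP_unaryCode.comp (fst unE (rawE outE))).congr fun _ => rfl
  have hlenU : CodeFP (pairE unE (rawE outE)) unE (fun p => (subOuts k p.2).length) :=
    ((ulength outE).comp hsub).congr fun _ => rfl
  have hM : CodeFP (pairE unE (rawE outE)) strE (fun p => LocalMap.unaryCode (subOuts k p.2).length) :=
    (codeFP_unaryCode.comp hlenU).congr fun _ => rfl
  have hbl : CodeFP (pairE unE (rawE outE)) strE (fun p => ((subOuts k p.2).map (blk p.1)).flatten) :=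
    (strFlatten.comp ((map codeFP_blk).comp ((fst _ _).pair hsub))).congr fun _ => rfl
  exact (strAppend.comp ((strAppend.comp (hN.pair hM)).pair hbl)).congr fun _ => rfl

variable {k}

/-- **Branch B is polynomial time, relative to a polynomial-time `f₀`.** -/
theorem codeFP_outB {f₀ : List Bool → List Bool} (hf₀ : IsPolyTime f₀) :
    CodeFP (pairE unE (rawE outE)) (rawE bitE) (fun p => outB k f₀ p.1 p.2) := by
  have hF : CodeFP strE strE f₀ := of_fn f₀ ((CookBridges.isPolyTime_iff f₀).1 hf₀) fun _ => rfl
  have hans : CodeFP (pairE unE (rawE outE)) strE (fun p => f₀ (subCode k p.1 p.2)) :=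
    (hF.comp (codeFP_subCode k)).congr fun _ => rfl
  have hrecs : CodeFP (pairE unE (rawE outE)) (rawE recE) (fun p => recs k p.2) :=
    ((codeFP_recs k).comp (snd unE (rawE outE))).congr fun _ => rfl
  have hnon : CodeFP (pairE unE (rawE outE)) (rawE natE) (fun p => nonIdx (recs k p.2)) :=
    (codeFP_nonIdx.comp hrecs).congr fun _ => rfl
  have hfind : CodeFP (pairE (pairE strE (rawE natE)) recE) natE (fun t => t.1.2.findIdx (· == t.2.1)) :=
    ((findIdxFP (σ := ℕ) (eσ := natE) (eα := natE) (p := fun q => q.2 == q.1)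
      ((beq natE_injective).comp ((snd natE natE).pair (fst natE natE)))).comp
      ((snd (pairE strE (rawE natE)) recE).fst'.pair (fst (pairE strE (rawE natE)) recE).snd')).congr fun _ => rfl
  have hbit : CodeFP (pairE (pairE strE (rawE natE)) recE) bitE (fun t => t.1.1.getD (t.1.2.findIdx (· == t.2.1)) false) :=
    (strGetDNat.comp ((fst (pairE strE (rawE natE)) recE).fst'.pair hfind)).congr fun _ => rfl
  have hg : CodeFP (pairE (pairE strE (rawE natE)) recE) bitE
      (fun t => !t.2.2.1 && t.1.1.getD (t.1.2.findIdx (· == t.2.1)) false) :=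
    (snd (pairE strE (rawE natE)) recE).snd'.fst'.not.and hbit
  exact ((map hg).comp ((hans.pair hnon).pair hrecs)).congr fun _ => rfl

/-- The solver on decoded data is polynomial time. -/
theorem codeFP_solve {f₀ : List Bool → List Bool} (hf₀ : IsPolyTime f₀) :
    CodeFP (pairE unE (rawE outE)) (rawE bitE) (fun p => solve k f₀ p.1 p.2) := by
  have hrecs : CodeFP (pairE unE (rawE outE)) (rawE recE) (fun p => recs k p.2) :=
    ((codeFP_recs k).comp (snd unE (rawE outE))).congr fun _ => rfl
  have haff : CodeFP (pairE unE (rawE outE)) (rawE recE) (fun p => affRecs (recs k p.2)) :=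
    (codeFP_affRecs.comp hrecs).congr fun _ => rfl
  have hlen : CodeFP (pairE unE (rawE outE)) natE (fun p => (affRecs (recs k p.2)).length) :=
    ((natLength recE).comp haff).congr fun _ => rfl
  have hN1 : CodeFP (pairE unE (rawE outE)) unE (fun p => p.1 + 1) := (unSucc.comp (fst unE (rawE outE))).congr fun _ => rfl
  have hc : CodeFP (pairE unE (rawE outE)) bitE (fun p => decide (p.1 + 1 ≤ (affRecs (recs k p.2)).length)) :=
    (unLeNat.comp (hN1.pair hlen)).congr fun _ => rfl
  have hA : CodeFP (pairE unE (rawE outE)) (rawE bitE) (fun p => outA p.1 (recs k p.2)) :=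
    (codeFP_outA.comp ((fst unE (rawE outE)).pair hrecs)).congr fun _ => rfl
  exact (hc.ite hA (codeFP_outB (k := k) hf₀)).congr fun p => by
    by_cases h : p.1 + 1 ≤ (affRecs (recs k p.2)).length <;> simp [solve, h]

/-- **The affine-split machine is computed on codes in polynomial time.** -/
theorem codeFP_affStr {f₀ : List Bool → List Bool} (hf₀ : IsPolyTime f₀) : CodeFP strE strE (affStr k f₀) :=
  (bitsToStr.comp ((codeFP_solve hf₀).comp (codeFP_hdrN.pair (codeFP_decode k)))).congr fun _ => rfl

/-- **`affStr k f₀` is polynomial-time computable** (`IsPolyTime`) whenever `f₀` is. -/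
theorem isPolyTime_affStr (k : ℕ) {f₀ : List Bool → List Bool} (hf₀ : IsPolyTime f₀) : IsPolyTime (affStr k f₀) := by
  obtain ⟨f, hf, hfw⟩ := codeFP_affStr (k := k) hf₀
  have h : f = affStr k f₀ := funext fun w => hfw w
  rw [h] at hf
  exact (CookBridges.isPolyTime_iff _).2 hf

end PolyTime

/-! ## The theorem -/

/-- **ROUND-18 item K3, THE AFFINE SPLIT, for every locality `k`**:
`SignDeg2OnlyAvoidLinearFP k → SignDeg2AvoidLinearFP k` — if range avoidance at linear stretch for the
`k`-local maps all of whose tables have sign-degree `≤ 2` is in FP (constant `C₀`, one polynomial-time `f₀`),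
then so is range avoidance at linear stretch for the `k`-local maps each of whose tables has sign-degree `≤ 2`
OR IS AFFINE (constant `C₀ + 1`, the one polynomial-time function `affStr k f₀`: Gaussian elimination on
`≥ n + 1` affine outputs, else `f₀` on the sub-instance of the non-affine outputs).  Restricted-model
algorithmic glue of the range-avoidance ladder (cell pnp-ideate, the pattern of `CandStarReduction`,
stmt-PneNP-19963); it says nothing about `P` versus `NP`. -/
theorem affineSplit (k : ℕ) : AffineSplit k := by
  unfold SignDeg2Signing.AffineSplit SignDeg2Signing.SignDeg2OnlyAvoidLinearFP SignDeg2Signing.SignDeg2AvoidLinearFP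
    LocalAvoidLinearFP
  rintro ⟨C₀, f₀, hf₀, hspec⟩
  exact ⟨C₀ + 1, affStr k f₀, isPolyTime_affStr k hf₀, fun n m I hI hn hm => affStr_correct hspec I hI hn hm⟩

end Summit.PneNP.PneNP.Theorems.AffineSplitFP
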